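import Summits.BirchSwinnertonDyer.BirchSwinnertonDyer.Theorems.ManinLocalTwoThreeTwistDefectFactFree
import Summits.BirchSwinnertonDyer.BirchSwinnertonDyer.Theorems.ManinLocalTwoThreeNewformPinningNinetySix

/-!
# THE DEFECT LAW OF THE TWIST GROUPOID, part 2 of 4: typed objects, the seventeen roots (NEW: `80`, `108`), families, shapes, additivity from the level
(cell bsd-f2-manin, desc g46 MEMO-desc §71 §2–§5, TURNKEY T-desc-58; landed by p1 gen 25)

Props E-desc-233 `OddTwistDefectLevelManinDvd M q`, E-desc-234 `TwoTwistDefectAdditiveLevelManinDvd M d`, E-desc-235 `NegOneTwistAdditiveLevelManinOneLF M`,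
each implied by `LevelManinOne M`; the NEW ROOTS `levelManinOne_eighty` (p798002) and `levelManinOne_oneHundredEight` (p800765); the families over the
seventeen complete levels; worked crux shapes on twist images; §5 the `hadd` binders DISCHARGED from the level (`KatoCurve.additive_of_sq_dvd_level`).
No named fact; C2, C3, Manin's conjecture and BSD are NOT proved.
[cite: Stevens1989, Lemma (5.2) p. 96, Lemma (5.4) p. 97, (5.6)–(5.7) p. 98] [cite: Pal2012, Prop. 2.4, Lemma 3.1]
[cite: Connell1999, §5.7.3] [cite: SilvermanAEC2009, Cor. VII.7.2, §C.16] [cite: SilvermanATAEC1994, Cor. IV.9.1] [cite: EdixhovenManin1991, Prop. 2]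
-/

set_option autoImplicit false
-- the summit-side namespace `Summit.BirchSwinnertonDyer.BirchSwinnertonDyer.…` is the tree's (summit = sub-problem)
set_option linter.dupNamespace false

noncomputable section

open scoped Classical NumberField MatrixGroups ModularForm

namespace Summit.BirchSwinnertonDyer.BirchSwinnertonDyer.Theorems.ManinLocalTwoThree.TwistDefect

open WeierstrassCurve CongruenceSubgroup IsDedekindDomain IsDedekindDomain.HeightOneSpectrum Rat.HeightOneSpectrum
  Literature.NumberTheory.Automorphic Literature.NumberTheory.EllipticCurves Literature.NumberTheory.EllipticCurves.ModularForms
  Literature.NumberTheory.LFunctions.PrimitiveQuadratic Summit.BirchSwinnertonDyer.BirchSwinnertonDyer.Theorems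
  Summit.BirchSwinnertonDyer.BirchSwinnertonDyer.Theorems.ManinLocalTwoThree Summit.BirchSwinnertonDyer.Rank1Residual.ManinAdditive
  Summit.BirchSwinnertonDyer.BirchSwinnertonDyer.Theorems.ManinLocalTwoThree.TwistFamilies
  Summit.BirchSwinnertonDyer.BirchSwinnertonDyer.Theorems.ManinLocalTwoThree.AdditiveTwistFamilies

/-! ## §2 The typed objects (CANDIDATES §E.76) -/

/-- **E-desc-233 `OddTwistDefectLevelManinDvd M q`** (`q` an odd prime) — THE ODD DEFECT LAW ON THE
`χ_{q*}`-TWIST IMAGE OF LEVEL `M`, ROOT ARBITRARY AT `q`: for every lattice-optimal `X₀(M)`-datum `D` on an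
elliptic `A`, every globally minimal `C = u • (A ⊗ q*)` with defect `r ≠ 0` (`r¹² Δ(C) = (q*)⁶ Δ(A)`), and
every globally minimal `W'` ADDITIVE at `q`, `W' ∼ A ⊗ ℚ(√q*)`, with a lattice-optimal `X₀(N)`-datum `D'`
(`M ∣ N`, `q² ∣ N`): `c(D') ∣ r`.  THEOREM for every complete `M` (§3).  Contains E-desc-232 (`r = 1`).
[cite: Stevens1989, Lemma (5.2), (5.4)] [cite: Pal2012, Lemma 3.1] -/
def OddTwistDefectLevelManinDvd (M q : ℕ) [NeZero M] [Fact q.Prime] : Prop :=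
  ∀ (A : WeierstrassCurve ℚ) [A.IsElliptic] [A.IsGloballyMinimal] (D : ModularParametrizationData A M),
    (∀ z ∈ D.L.lattice, ∃ w ∈ periodLattice D.f, z = D.c * w) →
  ∀ (C : WeierstrassCurve ℚ) [C.IsElliptic] [C.IsGloballyMinimal] (u : VariableChange ℚ) (r : ℤ),
    u • A.quadraticTwist (((-1 : ℤ) ^ (q / 2) * q : ℤ) : ℚ) = C → r ≠ 0 →
    (r : ℚ) ^ 12 * C.Δ = ((((-1 : ℤ) ^ (q / 2) * q : ℤ)) : ℚ) ^ 6 * A.Δ →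
  ∀ (W' : WeierstrassCurve ℚ) [W'.IsElliptic] [W'.IsGloballyMinimal] (N : ℕ) [NeZero N]
    (D' : ModularParametrizationData W' N), M ∣ N → q ^ 2 ∣ N →
    IsIsogenous W' (A.quadraticTwist (((-1 : ℤ) ^ (q / 2) * q : ℤ) : ℚ)) →
    (¬ W'.HasGoodReductionAtPrime q ∧ ¬ W'.HasMultiplicativeReductionAtPrime q) →
    (∀ z ∈ D'.L.lattice, ∃ w ∈ periodLattice D'.f, z = D'.c * w) → D'.maninConstant ∣ r

/-- **E-desc-234 `TwoTwistDefectAdditiveLevelManinDvd M d`** (`d = ±2`) — THE DYADIC DEFECT LAW ON THE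
`χ_{±8}`-TWIST IMAGE OF LEVEL `M` FROM A `2`-ADDITIVE ROOT, LEVEL-FREE: for every lattice-optimal
`X₀(M)`-datum `D` on a globally minimal `A` additive at `2`, every globally minimal `C = u • (A ⊗ d)` with
defect `r` (`r¹² Δ(C) = d⁶ Δ(A)`), and every globally minimal `W'` additive at `2`, `W' ∼ A ⊗ ℚ(√d)`, with a
lattice-optimal `X₀(N)`-datum `D'` (`4 ∣ N`, `M ∣ 2⁶N`): `c(D') ∣ r`.  THEOREM for every complete `M` with
`4 ∣ M` (§3).  Contains E-desc-231 (`r = 1`, and frees it from `M ∣ N`, `2⁶ ∣ N`).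
[cite: Stevens1989, Lemma (5.4)] [cite: Pal2012, Prop. 2.4, Lemma 3.1] -/
def TwoTwistDefectAdditiveLevelManinDvd (M : ℕ) [NeZero M] (d : ℤ) : Prop :=
  ∀ (A : WeierstrassCurve ℚ) [A.IsElliptic] [A.IsGloballyMinimal] (D : ModularParametrizationData A M),
    (∀ z ∈ D.L.lattice, ∃ w ∈ periodLattice D.f, z = D.c * w) →
    (¬ A.HasGoodReductionAtPrime 2 ∧ ¬ A.HasMultiplicativeReductionAtPrime 2) →
  ∀ (C : WeierstrassCurve ℚ) [C.IsElliptic] [C.IsGloballyMinimal] (u : VariableChange ℚ) (r : ℤ),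
    u • A.quadraticTwist (d : ℚ) = C → (r : ℚ) ^ 12 * C.Δ = (d : ℚ) ^ 6 * A.Δ →
  ∀ (W' : WeierstrassCurve ℚ) [W'.IsElliptic] [W'.IsGloballyMinimal] (N : ℕ) [NeZero N]
    (D' : ModularParametrizationData W' N), 2 ^ 2 ∣ N → M ∣ 2 ^ 6 * N →
    IsIsogenous W' (A.quadraticTwist (d : ℚ)) →
    (¬ W'.HasGoodReductionAtPrime 2 ∧ ¬ W'.HasMultiplicativeReductionAtPrime 2) →
    (∀ z ∈ D'.L.lattice, ∃ w ∈ periodLattice D'.f, z = D'.c * w) → D'.maninConstant ∣ r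

/-- **E-desc-235 `NegOneTwistAdditiveLevelManinOneLF M`** — `|c| = 1` ON THE `χ₋₄`-TWIST IMAGE OF LEVEL `M`
FROM A `2`-ADDITIVE ROOT, LEVEL-FREE: as E-desc-230 with `M ∣ N ∧ 2⁴ ∣ N` replaced by `4 ∣ N ∧ M ∣ 2⁴N`.
THEOREM for every complete `M` with `4 ∣ M` (§3). [cite: Stevens1989, Lemma (5.4)] [cite: Pal2012, Prop. 2.4, Lemma 3.1] -/
def NegOneTwistAdditiveLevelManinOneLF (M : ℕ) [NeZero M] : Prop :=
  ∀ (A : WeierstrassCurve ℚ) [A.IsElliptic] [A.IsGloballyMinimal] (D : ModularParametrizationData A M),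
    (∀ z ∈ D.L.lattice, ∃ w ∈ periodLattice D.f, z = D.c * w) →
    (¬ A.HasGoodReductionAtPrime 2 ∧ ¬ A.HasMultiplicativeReductionAtPrime 2) →
  ∀ (W' : WeierstrassCurve ℚ) [W'.IsElliptic] [W'.IsGloballyMinimal] (N : ℕ) [NeZero N]
    (D' : ModularParametrizationData W' N), 2 ^ 2 ∣ N → M ∣ 2 ^ 4 * N →
    IsIsogenous W' (A.quadraticTwist ((-1 : ℤ) : ℚ)) →
    (¬ W'.HasGoodReductionAtPrime 2 ∧ ¬ W'.HasMultiplicativeReductionAtPrime 2) →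
    (∀ z ∈ D'.L.lattice, ∃ w ∈ periodLattice D'.f, z = D'.c * w) → |D'.maninConstant| = 1

/-- **LevelManinOne M ⇒ OddTwistDefectLevelManinDvd M q for every odd prime `q`** (THEOREM 71.A, universally). -/
theorem oddTwistDefectLevelManinDvd_of_levelManinOne {M : ℕ} [NeZero M] (hM : LevelManinOne M)
    {q : ℕ} [Fact q.Prime] (hq2 : q ≠ 2) : OddTwistDefectLevelManinDvd M q :=
  fun A _ _ D hopt _C _ _ u _r hu hr hΔ _W' _ _ _N _ D' hMN hqN htw hadd' hopt' ↦
    maninConstant_dvd_defect_of_oddTwist hq2 D (hM A D hopt) u hu hr hΔ D' hMN hqN htw hadd' hopt'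

/-- **LevelManinOne M ∧ 4 ∣ M ⇒ TwoTwistDefectAdditiveLevelManinDvd M d, `d = ±2`** (THEOREM 71.B, universally). -/
theorem twoTwistDefectAdditiveLevelManinDvd_of_levelManinOne {M : ℕ} [NeZero M] (hM : LevelManinOne M)
    (h4M : 4 ∣ M) {d : ℤ} (hd : d = 2 ∨ d = -2) : TwoTwistDefectAdditiveLevelManinDvd M d :=
  fun A _ _ D hopt haddA _C _ _ u _r hu hΔ _W' _ _ _N _ D' h4N hML htw hadd' hopt' ↦
    maninConstant_dvd_defect_of_twoTwist_additive hd D (hM A D hopt) h4M haddA u hu hΔ D' h4N hML htw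
      hadd' hopt'

/-- **LevelManinOne M ∧ 4 ∣ M ⇒ NegOneTwistAdditiveLevelManinOneLF M** (THEOREM 71.C, universally). -/
theorem negOneTwistAdditiveLevelManinOneLF_of_levelManinOne {M : ℕ} [NeZero M] (hM : LevelManinOne M)
    (h4M : 4 ∣ M) : NegOneTwistAdditiveLevelManinOneLF M :=
  fun A _ _ D hopt haddA _W' _ _ _N _ D' h4N hML htw hadd' hopt' ↦
    abs_maninConstant_eq_one_of_negOneTwist_additive_levelFree D (hM A D hopt) h4M haddA D' h4N hML htw
      hadd' hopt'

/-! ## §3 The seventeen fact-free complete levels: the fifteen of `TwistFamilies` (landed) and the NEW ROOTS `80`, `108` -/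

/-- **NEW ROOT: level `80 = 2⁴·5`** (genus 7, TWO classes `80a`, `80b`; p2 g29 p798002, η-cusp basis of
`S₂(80)` + abstract pinning + Bracket–Sturm): `LevelManinOne 80`, fact-free. -/
theorem levelManinOne_eighty : LevelManinOne 80 :=
  fun W _ _ D h ↦ LevelEighty.abs_maninConstant_eq_one_eighty W D h

/-- **NEW ROOT: level `108 = 2²·3³`** (genus 10, ONE class `108a`, `j = 0`, twist-minimal, additive at 2 AND 3;
p1 g25 p800765 = p3 g24's capstone with `hpin` discharged by `LevelOneHundredEight.f_apply_eq_phi108`):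
`LevelManinOne 108`, fact-free.  A root for `χ₋₄` (71.C), `±8` (71.B) and `−3` (71.A, `q = 3`) twists INTO the
additive locus — the census projects 42 new classes in `N < 5·10⁵`, all with `36 ∣ N`. -/
theorem levelManinOne_oneHundredEight : LevelManinOne 108 :=
  fun W _ _ D h ↦ ManinConstantOneHundredEight.abs_maninConstant_eq_one_oneHundredEight W D h

/-- **NEW ROOT: level `96 = 2⁵·3`** (genus 9, TWO classes `96a`, `96b`, `v₂ = 5`; p1 g25 p802827 = p3 g24's two class squeezes with
`hpin` discharged by `LevelNinetySix.f_apply_eq_ninetySix`): `LevelManinOne 96`, fact-free (an eighteenth root; not yet entered in the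
family conjunctions below, which are desc g46's verbatim). -/
theorem levelManinOne_ninetySix : LevelManinOne 96 :=
  fun W _ _ D h ↦ LevelNinetySix.abs_maninConstant_eq_one_ninetySix W D h

/-- **THEOREM 71.D (i) — THE ODD DEFECT LAW ON ALL SEVENTEEN COMPLETE LEVELS**: for every odd prime `q` and
`M ∈ {20, 24, 27, 32, 36, 40, 44, 45, 48, 52, 54, 56, 63, 64, 72, 80, 108}`: `OddTwistDefectLevelManinDvd M q`. -/
theorem oddTwistDefect_families {q : ℕ} [Fact q.Prime] (hq2 : q ≠ 2) :
    OddTwistDefectLevelManinDvd 20 q ∧ OddTwistDefectLevelManinDvd 24 q ∧ OddTwistDefectLevelManinDvd 27 q ∧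
    OddTwistDefectLevelManinDvd 32 q ∧ OddTwistDefectLevelManinDvd 36 q ∧ OddTwistDefectLevelManinDvd 40 q ∧
    OddTwistDefectLevelManinDvd 44 q ∧ OddTwistDefectLevelManinDvd 45 q ∧ OddTwistDefectLevelManinDvd 48 q ∧
    OddTwistDefectLevelManinDvd 52 q ∧ OddTwistDefectLevelManinDvd 54 q ∧ OddTwistDefectLevelManinDvd 56 q ∧
    OddTwistDefectLevelManinDvd 63 q ∧ OddTwistDefectLevelManinDvd 64 q ∧ OddTwistDefectLevelManinDvd 72 q ∧
    OddTwistDefectLevelManinDvd 80 q ∧ OddTwistDefectLevelManinDvd 108 q :=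
  ⟨oddTwistDefectLevelManinDvd_of_levelManinOne levelManinOne_twenty hq2,
   oddTwistDefectLevelManinDvd_of_levelManinOne levelManinOne_twentyFour hq2,
   oddTwistDefectLevelManinDvd_of_levelManinOne levelManinOne_twentySeven hq2,
   oddTwistDefectLevelManinDvd_of_levelManinOne levelManinOne_thirtyTwo hq2,
   oddTwistDefectLevelManinDvd_of_levelManinOne levelManinOne_thirtySix hq2,
   oddTwistDefectLevelManinDvd_of_levelManinOne levelManinOne_forty hq2,
   oddTwistDefectLevelManinDvd_of_levelManinOne levelManinOne_fortyFour hq2,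
   oddTwistDefectLevelManinDvd_of_levelManinOne levelManinOne_fortyFive hq2,
   oddTwistDefectLevelManinDvd_of_levelManinOne levelManinOne_fortyEight hq2,
   oddTwistDefectLevelManinDvd_of_levelManinOne levelManinOne_fiftyTwo hq2,
   oddTwistDefectLevelManinDvd_of_levelManinOne levelManinOne_fiftyFour hq2,
   oddTwistDefectLevelManinDvd_of_levelManinOne levelManinOne_fiftySix hq2,
   oddTwistDefectLevelManinDvd_of_levelManinOne levelManinOne_sixtyThree hq2,
   oddTwistDefectLevelManinDvd_of_levelManinOne levelManinOne_sixtyFour hq2,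
   oddTwistDefectLevelManinDvd_of_levelManinOne levelManinOne_seventyTwo hq2,
   oddTwistDefectLevelManinDvd_of_levelManinOne levelManinOne_eighty hq2,
   oddTwistDefectLevelManinDvd_of_levelManinOne levelManinOne_oneHundredEight hq2⟩

/-- **THEOREM 71.D (ii) — THE DYADIC DEFECT LAW AND THE LEVEL-FREE `χ₋₄` LAW ON THE THIRTEEN `4 ∣ M` LEVELS**
`20, 24, 32, 36, 40, 44, 48, 52, 56, 64, 72, 80, 108`, for `d = ±2`. -/
theorem twoTwistDefect_families {d : ℤ} (hd : d = 2 ∨ d = -2) :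
    (TwoTwistDefectAdditiveLevelManinDvd 20 d ∧ NegOneTwistAdditiveLevelManinOneLF 20) ∧
    (TwoTwistDefectAdditiveLevelManinDvd 24 d ∧ NegOneTwistAdditiveLevelManinOneLF 24) ∧
    (TwoTwistDefectAdditiveLevelManinDvd 32 d ∧ NegOneTwistAdditiveLevelManinOneLF 32) ∧
    (TwoTwistDefectAdditiveLevelManinDvd 36 d ∧ NegOneTwistAdditiveLevelManinOneLF 36) ∧
    (TwoTwistDefectAdditiveLevelManinDvd 40 d ∧ NegOneTwistAdditiveLevelManinOneLF 40) ∧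
    (TwoTwistDefectAdditiveLevelManinDvd 44 d ∧ NegOneTwistAdditiveLevelManinOneLF 44) ∧
    (TwoTwistDefectAdditiveLevelManinDvd 48 d ∧ NegOneTwistAdditiveLevelManinOneLF 48) ∧
    (TwoTwistDefectAdditiveLevelManinDvd 52 d ∧ NegOneTwistAdditiveLevelManinOneLF 52) ∧
    (TwoTwistDefectAdditiveLevelManinDvd 56 d ∧ NegOneTwistAdditiveLevelManinOneLF 56) ∧
    (TwoTwistDefectAdditiveLevelManinDvd 64 d ∧ NegOneTwistAdditiveLevelManinOneLF 64) ∧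
    (TwoTwistDefectAdditiveLevelManinDvd 72 d ∧ NegOneTwistAdditiveLevelManinOneLF 72) ∧
    (TwoTwistDefectAdditiveLevelManinDvd 80 d ∧ NegOneTwistAdditiveLevelManinOneLF 80) ∧
    (TwoTwistDefectAdditiveLevelManinDvd 108 d ∧ NegOneTwistAdditiveLevelManinOneLF 108) :=
  ⟨⟨twoTwistDefectAdditiveLevelManinDvd_of_levelManinOne levelManinOne_twenty ⟨5, rfl⟩ hd,
    negOneTwistAdditiveLevelManinOneLF_of_levelManinOne levelManinOne_twenty ⟨5, rfl⟩⟩,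
   ⟨twoTwistDefectAdditiveLevelManinDvd_of_levelManinOne levelManinOne_twentyFour ⟨6, rfl⟩ hd,
    negOneTwistAdditiveLevelManinOneLF_of_levelManinOne levelManinOne_twentyFour ⟨6, rfl⟩⟩,
   ⟨twoTwistDefectAdditiveLevelManinDvd_of_levelManinOne levelManinOne_thirtyTwo ⟨8, rfl⟩ hd,
    negOneTwistAdditiveLevelManinOneLF_of_levelManinOne levelManinOne_thirtyTwo ⟨8, rfl⟩⟩,
   ⟨twoTwistDefectAdditiveLevelManinDvd_of_levelManinOne levelManinOne_thirtySix ⟨9, rfl⟩ hd,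
    negOneTwistAdditiveLevelManinOneLF_of_levelManinOne levelManinOne_thirtySix ⟨9, rfl⟩⟩,
   ⟨twoTwistDefectAdditiveLevelManinDvd_of_levelManinOne levelManinOne_forty ⟨10, rfl⟩ hd,
    negOneTwistAdditiveLevelManinOneLF_of_levelManinOne levelManinOne_forty ⟨10, rfl⟩⟩,
   ⟨twoTwistDefectAdditiveLevelManinDvd_of_levelManinOne levelManinOne_fortyFour ⟨11, rfl⟩ hd,
    negOneTwistAdditiveLevelManinOneLF_of_levelManinOne levelManinOne_fortyFour ⟨11, rfl⟩⟩,
   ⟨twoTwistDefectAdditiveLevelManinDvd_of_levelManinOne levelManinOne_fortyEight ⟨12, rfl⟩ hd,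
    negOneTwistAdditiveLevelManinOneLF_of_levelManinOne levelManinOne_fortyEight ⟨12, rfl⟩⟩,
   ⟨twoTwistDefectAdditiveLevelManinDvd_of_levelManinOne levelManinOne_fiftyTwo ⟨13, rfl⟩ hd,
    negOneTwistAdditiveLevelManinOneLF_of_levelManinOne levelManinOne_fiftyTwo ⟨13, rfl⟩⟩,
   ⟨twoTwistDefectAdditiveLevelManinDvd_of_levelManinOne levelManinOne_fiftySix ⟨14, rfl⟩ hd,
    negOneTwistAdditiveLevelManinOneLF_of_levelManinOne levelManinOne_fiftySix ⟨14, rfl⟩⟩,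
   ⟨twoTwistDefectAdditiveLevelManinDvd_of_levelManinOne levelManinOne_sixtyFour ⟨16, rfl⟩ hd,
    negOneTwistAdditiveLevelManinOneLF_of_levelManinOne levelManinOne_sixtyFour ⟨16, rfl⟩⟩,
   ⟨twoTwistDefectAdditiveLevelManinDvd_of_levelManinOne levelManinOne_seventyTwo ⟨18, rfl⟩ hd,
    negOneTwistAdditiveLevelManinOneLF_of_levelManinOne levelManinOne_seventyTwo ⟨18, rfl⟩⟩,
   ⟨twoTwistDefectAdditiveLevelManinDvd_of_levelManinOne levelManinOne_eighty ⟨20, rfl⟩ hd,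
    negOneTwistAdditiveLevelManinOneLF_of_levelManinOne levelManinOne_eighty ⟨20, rfl⟩⟩,
   ⟨twoTwistDefectAdditiveLevelManinDvd_of_levelManinOne levelManinOne_oneHundredEight ⟨27, rfl⟩ hd,
    negOneTwistAdditiveLevelManinOneLF_of_levelManinOne levelManinOne_oneHundredEight ⟨27, rfl⟩⟩⟩

/-! ## §4 Worked shapes: the crux conclusions on named twist images -/

/-- **C2-SHAPE on EVERY `q*`-twist image (any alignment) of the seventeen complete levels**: `2 ∤ c(D')` for
every lattice-optimal datum `D'` of a `q`-additive member `W' ∼ A ⊗ q*` (`A` the carrier of a lattice-optimal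
`X₀(M)`-datum), `M ∣ N`, `q² ∣ N`, the defect being UP or DOWN — e.g. root `M = 36` (`4 ∣ 36`): every such
member has `4 ∣ N`, i.e. lies in C2's domain. (Instance of 71.A; the seventeen `M` via `oddTwistDefect_families`.) -/
theorem maninOddAtFour_shape_on_oddTwist_image {M : ℕ} [NeZero M] (hM : LevelManinOne M)
    {q : ℕ} [Fact q.Prime] (hq2 : q ≠ 2)
    {A : WeierstrassCurve ℚ} [A.IsElliptic] [A.IsGloballyMinimal] (DA : ModularParametrizationData A M)
    (hoptA : ∀ z ∈ DA.L.lattice, ∃ w ∈ periodLattice DA.f, z = DA.c * w)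
    {C : WeierstrassCurve ℚ} [C.IsElliptic] [C.IsGloballyMinimal] (u : VariableChange ℚ)
    (hu : u • A.quadraticTwist (((-1 : ℤ) ^ (q / 2) * q : ℤ) : ℚ) = C)
    {r : ℤ} (hr : r = 1 ∨ r = q) (hΔ : (r : ℚ) ^ 12 * C.Δ = ((((-1 : ℤ) ^ (q / 2) * q : ℤ)) : ℚ) ^ 6 * A.Δ)
    {W' : WeierstrassCurve ℚ} [W'.IsElliptic] [W'.IsGloballyMinimal] {N : ℕ} [NeZero N]
    (D' : ModularParametrizationData W' N) (hMN : M ∣ N) (hqN : q ^ 2 ∣ N)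
    (htw : IsIsogenous W' (A.quadraticTwist (((-1 : ℤ) ^ (q / 2) * q : ℤ) : ℚ)))
    (hadd' : ¬ W'.HasGoodReductionAtPrime q ∧ ¬ W'.HasMultiplicativeReductionAtPrime q)
    (hopt' : ∀ z ∈ D'.L.lattice, ∃ w ∈ periodLattice D'.f, z = D'.c * w) :
    ¬ (2 : ℤ) ∣ D'.maninConstant := by
  have h := not_prime_dvd_maninConstant_of_oddTwist hq2 DA (hM A DA hoptA) u hu hr hΔ D' hMN hqN htw hadd'
    hopt' Nat.prime_two (Ne.symm hq2)
  simpa using h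

/-- **C3-SHAPE on EVERY `±8`-twist image (any alignment, any `2`-level) of a `2`-additive root of the twelve
`4 ∣ M` complete levels**: `3 ∤ c(D')` — e.g. roots `36a`, `72a` (`9 ∣ M`, so every member has `9 ∣ N`:
C3's domain) and the DOWN members `64a ⊗ χ_{±8} = 32a`-type. (Instance of 71.B.) -/
theorem maninPrimeToThree_shape_on_twoTwist_image {M : ℕ} [NeZero M] (hM : LevelManinOne M) (h4M : 4 ∣ M)
    {d : ℤ} (hd : d = 2 ∨ d = -2)
    {A : WeierstrassCurve ℚ} [A.IsElliptic] [A.IsGloballyMinimal] (DA : ModularParametrizationData A M)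
    (hoptA : ∀ z ∈ DA.L.lattice, ∃ w ∈ periodLattice DA.f, z = DA.c * w)
    (haddA : ¬ A.HasGoodReductionAtPrime 2 ∧ ¬ A.HasMultiplicativeReductionAtPrime 2)
    {C : WeierstrassCurve ℚ} [C.IsElliptic] [C.IsGloballyMinimal] (u : VariableChange ℚ)
    (hu : u • A.quadraticTwist (d : ℚ) = C) {r : ℤ} (hr : r = 1 ∨ r = 2)
    (hΔ : (r : ℚ) ^ 12 * C.Δ = (d : ℚ) ^ 6 * A.Δ)
    {W' : WeierstrassCurve ℚ} [W'.IsElliptic] [W'.IsGloballyMinimal] {N : ℕ} [NeZero N]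
    (D' : ModularParametrizationData W' N) (h4N : 2 ^ 2 ∣ N) (hML : M ∣ 2 ^ 6 * N)
    (htw : IsIsogenous W' (A.quadraticTwist (d : ℚ)))
    (hadd' : ¬ W'.HasGoodReductionAtPrime 2 ∧ ¬ W'.HasMultiplicativeReductionAtPrime 2)
    (hopt' : ∀ z ∈ D'.L.lattice, ∃ w ∈ periodLattice D'.f, z = D'.c * w) :
    ¬ (3 : ℤ) ∣ D'.maninConstant := by
  have h := not_prime_dvd_maninConstant_of_twoTwist_additive hd DA (hM A DA hoptA) h4M haddA u hu hr hΔ D'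
    h4N hML htw hadd' hopt' Nat.prime_three (by norm_num)
  simpa using h

/-! ## §5 ADDITIVITY DERIVED FROM THE LEVEL — the `hadd` binders of §1–§4 DISCHARGED (E-desc-236/237/238)

The tree theorem `KatoCurve.additive_of_sq_dvd_level p W f (hf : IsNewformOf W f) (h : p ^ 2 ∣ N) :
¬ W.HasGoodReductionAtPrime p ∧ ¬ W.HasMultiplicativeReductionAtPrime p`
(`Rank1Residual/ManinAdditive/TowerUnitTwist.lean`; fact-free: `IsNewformOf.dvd_level_iff_dvd_conductorNorm` — q-expansion
arithmetic — and `SkinnerUrban2014.not_sq_dvd_level_of_hasMultiplicativeReductionAtPrime`, both PROVED) derives the additivity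
of the carrier of an `X₀(N)`-datum at every prime whose square divides the LEVEL.  Hence every additivity hypothesis of
71.A (`hadd`, from `q² ∣ N`), 71.B/71.C (`haddA` from `4 ∣ M`, `hadd'` from `4 ∣ N`) is REDUNDANT given the datum: the laws
below carry NO local hypothesis at all — the instantiation layer of §68–§71 loses its «Tate's algorithm» item.
(This does not contradict g45's (α) «A additive ⇏ A ⊗ (−1) additive» — additivity is read off the MEMBER's level, not
transported from the root.) -/

/-- **E-desc-236 `OddTwistDefectManinDvd M q`** — E-desc-233 with the additivity binder REMOVED (it follows from `q² ∣ N`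
at the datum `D'`). [cite: Stevens1989, Lemma (5.2), (5.4)] [cite: Pal2012, Lemma 3.1] -/
def OddTwistDefectManinDvd (M q : ℕ) [NeZero M] [Fact q.Prime] : Prop :=
  ∀ (A : WeierstrassCurve ℚ) [A.IsElliptic] [A.IsGloballyMinimal] (D : ModularParametrizationData A M),
    (∀ z ∈ D.L.lattice, ∃ w ∈ periodLattice D.f, z = D.c * w) →
  ∀ (C : WeierstrassCurve ℚ) [C.IsElliptic] [C.IsGloballyMinimal] (u : VariableChange ℚ) (r : ℤ),
    u • A.quadraticTwist (((-1 : ℤ) ^ (q / 2) * q : ℤ) : ℚ) = C → r ≠ 0 →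
    (r : ℚ) ^ 12 * C.Δ = ((((-1 : ℤ) ^ (q / 2) * q : ℤ)) : ℚ) ^ 6 * A.Δ →
  ∀ (W' : WeierstrassCurve ℚ) [W'.IsElliptic] [W'.IsGloballyMinimal] (N : ℕ) [NeZero N]
    (D' : ModularParametrizationData W' N), M ∣ N → q ^ 2 ∣ N →
    IsIsogenous W' (A.quadraticTwist (((-1 : ℤ) ^ (q / 2) * q : ℤ) : ℚ)) →
    (∀ z ∈ D'.L.lattice, ∃ w ∈ periodLattice D'.f, z = D'.c * w) → D'.maninConstant ∣ r

/-- **E-desc-237 `TwoTwistDefectManinDvd M d`** (`d = ±2`, `4 ∣ M`) — E-desc-234 with BOTH additivity binders REMOVED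
(root: `4 ∣ M`; member: `4 ∣ N`); LEVEL-FREE (`M ∣ 2⁶N`). [cite: Stevens1989, Lemma (5.4)] [cite: Pal2012, Prop. 2.4, Lemma 3.1] -/
def TwoTwistDefectManinDvd (M : ℕ) [NeZero M] (d : ℤ) : Prop :=
  ∀ (A : WeierstrassCurve ℚ) [A.IsElliptic] [A.IsGloballyMinimal] (D : ModularParametrizationData A M),
    (∀ z ∈ D.L.lattice, ∃ w ∈ periodLattice D.f, z = D.c * w) →
  ∀ (C : WeierstrassCurve ℚ) [C.IsElliptic] [C.IsGloballyMinimal] (u : VariableChange ℚ) (r : ℤ),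
    u • A.quadraticTwist (d : ℚ) = C → (r : ℚ) ^ 12 * C.Δ = (d : ℚ) ^ 6 * A.Δ →
  ∀ (W' : WeierstrassCurve ℚ) [W'.IsElliptic] [W'.IsGloballyMinimal] (N : ℕ) [NeZero N]
    (D' : ModularParametrizationData W' N), 2 ^ 2 ∣ N → M ∣ 2 ^ 6 * N →
    IsIsogenous W' (A.quadraticTwist (d : ℚ)) →
    (∀ z ∈ D'.L.lattice, ∃ w ∈ periodLattice D'.f, z = D'.c * w) → D'.maninConstant ∣ r

/-- **E-desc-238 `NegOneTwistManinOneLF M`** (`4 ∣ M`) — E-desc-235 with BOTH additivity binders REMOVED: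
`|c| = 1` on the `χ₋₄`-image, level-free (`4 ∣ N`, `M ∣ 2⁴N`), NO local hypothesis.
[cite: Stevens1989, Lemma (5.4)] [cite: Pal2012, Prop. 2.4, Lemma 3.1] -/
def NegOneTwistManinOneLF (M : ℕ) [NeZero M] : Prop :=
  ∀ (A : WeierstrassCurve ℚ) [A.IsElliptic] [A.IsGloballyMinimal] (D : ModularParametrizationData A M),
    (∀ z ∈ D.L.lattice, ∃ w ∈ periodLattice D.f, z = D.c * w) →
  ∀ (W' : WeierstrassCurve ℚ) [W'.IsElliptic] [W'.IsGloballyMinimal] (N : ℕ) [NeZero N]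
    (D' : ModularParametrizationData W' N), 2 ^ 2 ∣ N → M ∣ 2 ^ 4 * N →
    IsIsogenous W' (A.quadraticTwist ((-1 : ℤ) : ℚ)) →
    (∀ z ∈ D'.L.lattice, ∃ w ∈ periodLattice D'.f, z = D'.c * w) → |D'.maninConstant| = 1

/-- E-desc-233 ⇒ E-desc-236: the member's additivity at `q` comes from `q² ∣ N`. -/
theorem oddTwistDefectManinDvd_of {M q : ℕ} [NeZero M] [Fact q.Prime] (h : OddTwistDefectLevelManinDvd M q) :
    OddTwistDefectManinDvd M q :=
  fun A _ _ D hopt C _ _ u r hu hr hΔ W' _ _ N _ D' hMN hqN htw hopt' ↦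
    h A D hopt C u r hu hr hΔ W' N D' hMN hqN htw
      (KatoCurve.additive_of_sq_dvd_level q W' D'.f D'.isNewformOf hqN) hopt'

/-- E-desc-234 ⇒ E-desc-237 (`4 ∣ M`): both additivities come from the levels. -/
theorem twoTwistDefectManinDvd_of {M : ℕ} [NeZero M] (h4M : 4 ∣ M) {d : ℤ}
    (h : TwoTwistDefectAdditiveLevelManinDvd M d) : TwoTwistDefectManinDvd M d :=
  fun A _ _ D hopt C _ _ u r hu hΔ W' _ _ N _ D' h4N hML htw hopt' ↦
    h A D hopt (KatoCurve.additive_of_sq_dvd_level 2 A D.f D.isNewformOf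
        (by rw [show (2 : ℕ) ^ 2 = 4 by norm_num]; exact h4M))
      C u r hu hΔ W' N D' h4N hML htw (KatoCurve.additive_of_sq_dvd_level 2 W' D'.f D'.isNewformOf h4N) hopt'

/-- E-desc-235 ⇒ E-desc-238 (`4 ∣ M`). -/
theorem negOneTwistManinOneLF_of {M : ℕ} [NeZero M] (h4M : 4 ∣ M) (h : NegOneTwistAdditiveLevelManinOneLF M) :
    NegOneTwistManinOneLF M :=
  fun A _ _ D hopt W' _ _ N _ D' h4N hML htw hopt' ↦
    h A D hopt (KatoCurve.additive_of_sq_dvd_level 2 A D.f D.isNewformOf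
        (by rw [show (2 : ℕ) ^ 2 = 4 by norm_num]; exact h4M))
      W' N D' h4N hML htw (KatoCurve.additive_of_sq_dvd_level 2 W' D'.f D'.isNewformOf h4N) hopt'

/-- **THE ADDITIVITY-FREE LAWS FROM `LevelManinOne` ALONE**: for every complete `M` (and `4 ∣ M` for the dyadic ones). -/
theorem oddTwistDefectManinDvd_of_levelManinOne {M : ℕ} [NeZero M] (hM : LevelManinOne M) {q : ℕ} [Fact q.Prime]
    (hq2 : q ≠ 2) : OddTwistDefectManinDvd M q :=
  oddTwistDefectManinDvd_of (oddTwistDefectLevelManinDvd_of_levelManinOne hM hq2)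

/-- `LevelManinOne M ∧ 4 ∣ M` ⟹ the level-free dyadic defect law `TwoTwistDefectManinDvd M d` (`d = ±2`). [cite: Stevens1989, Lemma (5.4) p. 97] -/
theorem twoTwistDefectManinDvd_of_levelManinOne {M : ℕ} [NeZero M] (hM : LevelManinOne M) (h4M : 4 ∣ M)
    {d : ℤ} (hd : d = 2 ∨ d = -2) : TwoTwistDefectManinDvd M d :=
  twoTwistDefectManinDvd_of h4M (twoTwistDefectAdditiveLevelManinDvd_of_levelManinOne hM h4M hd)

/-- `LevelManinOne M ∧ 4 ∣ M` ⟹ the level-free `χ₋₄` law `NegOneTwistManinOneLF M`. [cite: Pal2012, Prop. 2.4] -/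
theorem negOneTwistManinOneLF_of_levelManinOne {M : ℕ} [NeZero M] (hM : LevelManinOne M) (h4M : 4 ∣ M) :
    NegOneTwistManinOneLF M :=
  negOneTwistManinOneLF_of h4M (negOneTwistAdditiveLevelManinOneLF_of_levelManinOne hM h4M)

/-- **Example: the new root `108`** — all three additivity-free laws, for every odd prime `q` and `d = ±2`. -/
theorem additivityFree_laws_oneHundredEight {q : ℕ} [Fact q.Prime] (hq2 : q ≠ 2) {d : ℤ} (hd : d = 2 ∨ d = -2) :
    OddTwistDefectManinDvd 108 q ∧ TwoTwistDefectManinDvd 108 d ∧ NegOneTwistManinOneLF 108 :=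
  ⟨oddTwistDefectManinDvd_of_levelManinOne levelManinOne_oneHundredEight hq2,
   twoTwistDefectManinDvd_of_levelManinOne levelManinOne_oneHundredEight ⟨27, rfl⟩ hd,
   negOneTwistManinOneLF_of_levelManinOne levelManinOne_oneHundredEight ⟨27, rfl⟩⟩

/-- **C2-SHAPE, NO LOCAL HYPOTHESIS**: `2 ∤ c(D')` on the `q*`-twist image of a complete level, the member given only
by its datum (`M ∣ N`, `q² ∣ N`), its isogeny to `A ⊗ q*` and the defect `r ∈ {1, q}` of a minimal model. -/
theorem not_two_dvd_maninConstant_on_oddTwist_image {M : ℕ} [NeZero M] (hM : LevelManinOne M)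
    {q : ℕ} [Fact q.Prime] (hq2 : q ≠ 2)
    {A : WeierstrassCurve ℚ} [A.IsElliptic] [A.IsGloballyMinimal] (DA : ModularParametrizationData A M)
    (hoptA : ∀ z ∈ DA.L.lattice, ∃ w ∈ periodLattice DA.f, z = DA.c * w)
    {C : WeierstrassCurve ℚ} [C.IsElliptic] [C.IsGloballyMinimal] (u : VariableChange ℚ)
    (hu : u • A.quadraticTwist (((-1 : ℤ) ^ (q / 2) * q : ℤ) : ℚ) = C) {r : ℤ} (hr : r = 1 ∨ r = q)
    (hΔ : (r : ℚ) ^ 12 * C.Δ = ((((-1 : ℤ) ^ (q / 2) * q : ℤ)) : ℚ) ^ 6 * A.Δ)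
    {W' : WeierstrassCurve ℚ} [W'.IsElliptic] [W'.IsGloballyMinimal] {N : ℕ} [NeZero N]
    (D' : ModularParametrizationData W' N) (hMN : M ∣ N) (hqN : q ^ 2 ∣ N)
    (htw : IsIsogenous W' (A.quadraticTwist (((-1 : ℤ) ^ (q / 2) * q : ℤ) : ℚ)))
    (hopt' : ∀ z ∈ D'.L.lattice, ∃ w ∈ periodLattice D'.f, z = D'.c * w) :
    ¬ (2 : ℤ) ∣ D'.maninConstant :=
  maninOddAtFour_shape_on_oddTwist_image hM hq2 DA hoptA u hu hr hΔ D' hMN hqN htw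
    (KatoCurve.additive_of_sq_dvd_level q W' D'.f D'.isNewformOf hqN) hopt'



end Summit.BirchSwinnertonDyer.BirchSwinnertonDyer.Theorems.ManinLocalTwoThree.TwistDefect

end
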